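import Mathlib
import Literature.RepresentationTheory.AlgebraicGroups.CayleyOmegaProcess
import HarnessLib

/-!
# [ASSS16] §4 / §7.3: the algebra of iterated partial derivatives behind the "gcd trick"
# (Lemma 4.1) and "evolution via factoring" (Lemma 4.2) — model-independent layer, proofs only

M. Agrawal, C. Saha, R. Saptharishi, N. Saxena, *Jacobian hits circuits: hitting sets, lower bounds
for depth-D occur-k formulas and depth-3 transcendence-degree-k circuits*, STOC 2012 / SIAM J.
Comput. 45 (2016) = arXiv:1111.0582 [AgrawalEtAl2011], §4 (p0009–p0010) with proofs in §7.3
(p0018:L39–L130). Printed set-up (p0009:L79–L83): "For any multiset of variables `S`, let `Δ_S f`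
denote the partial derivative of `f` with respect to the variables in `S` (including repetitions, as
`S` is a multiset). Let `var(S)` denote the set of distinct variables in `S`."

RENDERING. A multiset `S` of variables from `σ` is a finitely supported `β : σ →₀ ℕ`
(`var(S) = β.support`, `|S| = β.degree`), and `Δ_S` is the tree's iterated partial derivative
`Literature.RepresentationTheory.AlgebraicGroups.iterPderiv β` (`CayleyOmegaProcess.lean`:
`iterPderiv_add`, `iterPderiv_single`, `iterPderiv_zero`; `∂^{e_i} = pderiv i`). This file proves
the POLYNOMIAL-LEVEL facts the two printed proofs use, for arbitrary finite families of
polynomials `H_j` (the "children of a gate"); the occur-`k` FORMULA model (FSV Def. 45,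
`OccurFormula`) is not touched here — the bridge "child `H_j` depends on `x_i` ⇒ a leaf below it
contains `x_i`" and the level recursion belong to the formula-level files of the N1 push.

* `ASSS16.derivation_apply_mem_adjoin`, `ASSS16.iterPderiv_mem_adjoin`,
  `ASSS16.iterPderiv_prod_pow_mem_adjoin` — "`Δ_{S_i} G'` is a polynomial in the children of `G'`
  and their … derivatives (of order between one and `c_ℓ + 1`)" (Lemma 4.2, proof, p0018:L101–L110):
  a derivation maps `R[A]` into `R[A ∪ D(A)]`; hence `Δ_β` maps `R[A]` into
  `R[Δ_γ a : a ∈ A, γ ≤ β]`, in particular `Δ_β (∏_j H_j^{e_j}) ∈ R[Δ_γ H_j : j, γ ≤ β]`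
  ("Note the irrelevance of the exponents `e_{i,ℓ}`'s", p0009:L52).
* `ASSS16.iterPderiv_mul_left_of_forall_notMem_vars`, `ASSS16.iterPderiv_prod_pow_eq_mul_filter`,
  `ASSS16.iterPderiv_sum_eq_sum_filter` — **Lemma 4.1 (gcd trick) at the level of polynomials**
  (p0018:L53–L62): for a `×∧` gate `G = ∏ H_j^{e_j}`, `Δ_{S} G = V_G · Δ_{S} G'` with `G'` the
  product of the children depending on the variables of `S` and `V_G = G/G'` the product of the
  others (stated for any predicate `P` containing the dependent children, so that ONE `V_G` serves a
  whole family `S_1, …, S_w`); for a `+` gate `Δ_S G = Δ_S G'` (`S ≠ ∅`).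
* `ASSS16.iterPderiv_eq_zero_of_notMem_vars` — "the other gates are independent of the variables in
  `∪ S_i`" (p0018:L56).
* `ASSS16.card_filter_dependsOn_le` — the occur count "at most `k · |∪ var(S_i)|` of the children
  depend on the variables present in `∪ var(S_i)`" (p0018:L54, L59) from "each variable occurs in at
  most `k` children"; `ASSS16.card_Iic_le_two_pow_degree` — the number of sub-multisets `T ⊆ S` is
  `≤ 2^{|S|}` ("at most `(2^{c_ℓ+1} - 1)` … derivatives", p0018:L110).
* `ASSS16.det_mem_subalgebra`, `ASSS16.det_eq_prod_mul_det_of_row_factor` — "in `det(M)` we can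
  take `V_G` common from each of these `e_G` rows such that the elements present inside the
  determinant are of the form `Δ_{S_i} G'`" (p0018:L97–L100) and "`det(…)` is a polynomial in
  `P_{i,ℓ}` and `∂_j P_{i,ℓ}`" (p0009:L50).

No definitions, no named facts. Honest framing: 2011/2016 algebra re-proved for the cell's N1
bookkeeping (FSV 2018 Thm. 48 / Cor. 49 bypass); nothing here bears on `VP ≠ VNP`.

## References
* [AgrawalEtAl2011] arXiv:1111.0582, §4 Lemma 4.1, Lemma 4.2 (= `lem:derivative-content`,
  `lem:descent-jacobian`), proofs §7.3 (locator: paper:arxiv-1111.0582 p0009.txt:L79 –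
  p0010.txt:L21; p0018.txt:L39–L130).
-/

noncomputable section

open MvPolynomial Finset

open scoped BigOperators

open Literature.RepresentationTheory.AlgebraicGroups (iterPderiv iterPderiv_add iterPderiv_single
  iterPderiv_zero)

namespace Literature.Computability.AlgebraicComplexity

namespace ASSS16

variable {R : Type*} [CommRing R] {σ : Type*}

/-! ### One derivative at a time: induction on the multiset `S` -/

/-- Induction on multisets of variables by adjoining one variable: `Δ_{S + x_a} = ∂_a ∘ Δ_S`
("including repetitions, as `S` is a multiset"). [cite: AgrawalEtAl2011, §4 (definition of `Δ_S`)]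
locator: paper:arxiv-1111.0582 p0009.txt:L79–L83 -/
theorem finsupp_single_one_induction {P : (σ →₀ ℕ) → Prop} (h0 : P 0)
    (hstep : ∀ (a : σ) (γ : σ →₀ ℕ), P γ → P (Finsupp.single a 1 + γ)) (β : σ →₀ ℕ) : P β := by
  induction β using Finsupp.induction with
  | zero => exact h0
  | single_add a b f _ hb ih =>
    clear hb
    induction b with
    | zero => rwa [Finsupp.single_zero, zero_add]
    | succ b ihb =>
      rw [Finsupp.single_add, add_comm (Finsupp.single a b) (Finsupp.single a 1), add_assoc]
      exact hstep a _ ihb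

/-- `Δ_{x_a + S} f = ∂_a (Δ_S f)`. [cite: AgrawalEtAl2011, §4 (definition of `Δ_S`)]
locator: paper:arxiv-1111.0582 p0009.txt:L79–L83 -/
theorem iterPderiv_single_add_apply (a : σ) (γ : σ →₀ ℕ) (f : MvPolynomial σ R) :
    iterPderiv (A := R) (Finsupp.single a 1 + γ) f = pderiv a (iterPderiv (A := R) γ f) := by
  rw [iterPderiv_add, iterPderiv_single, LinearMap.comp_apply]
  rfl

/-! ### Derivatives of polynomial expressions stay polynomial in the derivatives (Lemma 4.2, proof) -/

/-- A derivation `D` maps the subalgebra generated by `A` into the subalgebra generated by `A` and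
`D(A)` (Leibniz rule; the step behind "`Δ_{S_i} G'` is a polynomial combination of the `H_i`'s and
`{Δ_T H_j}`"). [cite: AgrawalEtAl2011, Lemma 4.2 (= lem:descent-jacobian), proof]
locator: paper:arxiv-1111.0582 p0018.txt:L101–L108 -/
theorem derivation_apply_mem_adjoin {S : Type*} [CommRing S] [Algebra R S] (D : Derivation R S S)
    (A : Set S) {x : S} (hx : x ∈ Algebra.adjoin R A) :
    D x ∈ Algebra.adjoin R (A ∪ D '' A) := by
  have hsub : Algebra.adjoin R A ≤ Algebra.adjoin R (A ∪ D '' A) :=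
    Algebra.adjoin_mono Set.subset_union_left
  induction hx using Algebra.adjoin_induction with
  | mem x hx => exact Algebra.subset_adjoin (Or.inr ⟨x, hx, rfl⟩)
  | algebraMap r => rw [Derivation.map_algebraMap]; exact zero_mem _
  | add x y hx hy ihx ihy => rw [map_add]; exact add_mem ihx ihy
  | mul x y hx hy ihx ihy =>
    rw [Derivation.leibniz, smul_eq_mul, smul_eq_mul]
    exact add_mem (mul_mem (hsub hx) ihy) (mul_mem (hsub hy) ihx)

/-- **"Polynomial in the derivatives":** if `f ∈ R[A]` then `Δ_β f ∈ R[Δ_γ a : a ∈ A, γ ≤ β]`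
(all sub-multisets `γ ≤ β`, `γ = 0` giving `A` itself).
[cite: AgrawalEtAl2011, Lemma 4.2 (= lem:descent-jacobian), proof ("is a polynomial in the children of `G'` and their … derivatives")]
locator: paper:arxiv-1111.0582 p0018.txt:L101–L110 -/
theorem iterPderiv_mem_adjoin (A : Set (MvPolynomial σ R)) (β : σ →₀ ℕ) {f : MvPolynomial σ R}
    (hf : f ∈ Algebra.adjoin R A) :
    iterPderiv (A := R) β f ∈
      Algebra.adjoin R {g | ∃ a ∈ A, ∃ γ : σ →₀ ℕ, γ ≤ β ∧ g = iterPderiv (A := R) γ a} := by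
  revert f
  refine finsupp_single_one_induction (P := fun β => ∀ {f : MvPolynomial σ R},
    f ∈ Algebra.adjoin R A → iterPderiv (A := R) β f ∈
      Algebra.adjoin R {g | ∃ a ∈ A, ∃ γ : σ →₀ ℕ, γ ≤ β ∧ g = iterPderiv (A := R) γ a}) ?_ ?_ β
  · intro f hf
    rw [iterPderiv_zero, LinearMap.id_apply]
    refine Algebra.adjoin_mono (fun a ha => ?_) hf
    exact ⟨a, ha, 0, le_rfl, by rw [iterPderiv_zero, LinearMap.id_apply]⟩
  · intro a γ ih f hf
    rw [iterPderiv_single_add_apply]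
    have h := derivation_apply_mem_adjoin (pderiv a) _ (ih hf)
    refine Algebra.adjoin_mono ?_ h
    rintro g (⟨b, hb, δ, hδ, rfl⟩ | ⟨_, ⟨b, hb, δ, hδ, rfl⟩, rfl⟩)
    · exact ⟨b, hb, δ, hδ.trans (by simp), rfl⟩
    · exact ⟨b, hb, Finsupp.single a 1 + δ, add_le_add le_rfl hδ,
        (iterPderiv_single_add_apply a δ b).symm⟩

/-- **Lemma 4.2's use of it for a `×∧` gate:** `Δ_β (∏_{j ∈ s} H_j^{e_j})` is a polynomial in the
derivatives `Δ_γ H_j`, `j ∈ s`, `γ ≤ β` ("`det(∂_j ∏ P_{i,ℓ}^{e_{i,ℓ}})` is a polynomial in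
`P_{i,ℓ}` and `∂_j P_{i,ℓ}` … Note the irrelevance of the exponents").
[cite: AgrawalEtAl2011, §4 (proof idea) and Lemma 4.2 (= lem:descent-jacobian), proof]
locator: paper:arxiv-1111.0582 p0009.txt:L48–L52; p0018.txt:L104–L110 -/
theorem iterPderiv_prod_pow_mem_adjoin {J : Type*} (s : Finset J) (H : J → MvPolynomial σ R)
    (e : J → ℕ) (β : σ →₀ ℕ) :
    iterPderiv (A := R) β (∏ j ∈ s, H j ^ e j) ∈
      Algebra.adjoin R {g | ∃ j ∈ s, ∃ γ : σ →₀ ℕ, γ ≤ β ∧ g = iterPderiv (A := R) γ (H j)} := by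
  have hf : (∏ j ∈ s, H j ^ e j) ∈ Algebra.adjoin R ((fun j => H j) '' (s : Set J)) :=
    prod_mem fun j hj => pow_mem (Algebra.subset_adjoin
      (Set.mem_image_of_mem (fun j => H j) (Finset.mem_coe.mpr hj))) _
  refine Algebra.adjoin_mono ?_ (iterPderiv_mem_adjoin _ β hf)
  rintro g ⟨_, ⟨j, hj, rfl⟩, γ, hγ, rfl⟩
  exact ⟨j, hj, γ, hγ, rfl⟩

/-- … and for a `+` gate: `Δ_β (∑_{j ∈ s} H_j) = ∑_j Δ_β H_j` (linearity; "`Δ_{S_i}G'` is the sum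
of the derivatives of … its children"). [cite: AgrawalEtAl2011, Lemma 4.2 (= lem:descent-jacobian), proof]
locator: paper:arxiv-1111.0582 p0018.txt:L102–L104 -/
theorem iterPderiv_sum {J : Type*} (s : Finset J) (H : J → MvPolynomial σ R) (β : σ →₀ ℕ) :
    iterPderiv (A := R) β (∑ j ∈ s, H j) = ∑ j ∈ s, iterPderiv (A := R) β (H j) :=
  map_sum _ _ _

/-! ### The gcd trick (Lemma 4.1 = lem:derivative-content) at the level of polynomials -/

/-- "The other gates are independent of the variables in `∪ S_i`": if some variable of the multiset
`β` does not occur in `f` then `Δ_β f = 0`. [cite: AgrawalEtAl2011, Lemma 4.1 (= lem:derivative-content), proof]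
locator: paper:arxiv-1111.0582 p0018.txt:L55–L56 -/
theorem iterPderiv_eq_zero_of_notMem_vars {β : σ →₀ ℕ} {i : σ} (hi : i ∈ β.support)
    {f : MvPolynomial σ R} (hf : i ∉ f.vars) : iterPderiv (A := R) β f = 0 := by
  have hle : Finsupp.single i 1 ≤ β :=
    Finsupp.single_le_iff.mpr (Nat.one_le_iff_ne_zero.mpr (Finsupp.mem_support_iff.mp hi))
  have hβ : β = (β - Finsupp.single i 1) + Finsupp.single i 1 := (tsub_add_cancel_of_le hle).symm
  rw [hβ, iterPderiv_add, LinearMap.comp_apply, iterPderiv_single]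
  show iterPderiv (A := R) (β - Finsupp.single i 1) (pderiv i f) = 0
  rw [pderiv_eq_zero_of_notMem_vars hf, map_zero]

/-- A factor free of the variables of `β` passes through `Δ_β`: `Δ_β (c·f) = c · Δ_β f`
("`Δ_{S_i} G = V_G · Δ_{S_i} G'`"). [cite: AgrawalEtAl2011, Lemma 4.1 (= lem:derivative-content), proof (second bullet)]
locator: paper:arxiv-1111.0582 p0018.txt:L58–L62 -/
theorem iterPderiv_mul_left_of_forall_notMem_vars (β : σ →₀ ℕ) {c : MvPolynomial σ R}
    (hc : ∀ i ∈ β.support, i ∉ c.vars) (f : MvPolynomial σ R) :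
    iterPderiv (A := R) β (c * f) = c * iterPderiv (A := R) β f := by
  revert hc
  refine finsupp_single_one_induction (P := fun β => (∀ i ∈ β.support, i ∉ c.vars) →
    iterPderiv (A := R) β (c * f) = c * iterPderiv (A := R) β f) ?_ ?_ β
  · intro _
    rw [iterPderiv_zero, LinearMap.id_apply, LinearMap.id_apply]
  · intro a γ ih hc
    have hγ : ∀ i ∈ γ.support, i ∉ c.vars := fun i hi => hc i (by
      rw [Finsupp.mem_support_iff] at hi ⊢
      rw [Finsupp.add_apply]
      omega)
    have ha : a ∉ c.vars := hc a (by
      rw [Finsupp.mem_support_iff, Finsupp.add_apply, Finsupp.single_eq_same]; omega)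
    rw [iterPderiv_single_add_apply, iterPderiv_single_add_apply, ih hγ, Derivation.leibniz,
      smul_eq_mul, smul_eq_mul, pderiv_eq_zero_of_notMem_vars ha, mul_zero, add_zero]

/-- The children free of the variables of `β` form a factor free of those variables.
[cite: AgrawalEtAl2011, Lemma 4.1 (= lem:derivative-content), proof (second bullet)]
locator: paper:arxiv-1111.0582 p0018.txt:L58–L62 -/
theorem notMem_vars_prod_pow [DecidableEq σ] {J : Type*} (s : Finset J) (H : J → MvPolynomial σ R)
    (e : J → ℕ) {i : σ} (h : ∀ j ∈ s, i ∉ (H j).vars) : i ∉ (∏ j ∈ s, H j ^ e j).vars := by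
  intro hi
  obtain ⟨j, hj, hij⟩ := Finset.mem_biUnion.mp (vars_prod (fun j => H j ^ e j) hi)
  exact h j hj (vars_pow (H j) (e j) hij)

/-- **Lemma 4.1 (gcd trick), `×∧` gate, polynomial level:** for `G = ∏_{j ∈ s} H_j^{e_j}` and a
predicate `P` holding for every child that depends on a variable of `β` ("at most `k·|∪ var(S_i)|`
of the `H_i`'s depend on the variables in `∪ S_i`; call these `H_1, …, H_t`. Let
`G' := H_1^{e_1} ⋯ H_t^{e_t}` and `V_G := G/G'`. Then `Δ_{S_i} G = V_G · Δ_{S_i} G'`"):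
`Δ_β G = (∏_{¬P} H_j^{e_j}) · Δ_β (∏_{P} H_j^{e_j})`. Taking `P` = "depends on `∪_i var(S_i)`" gives
ONE `V_G` for the whole family `S_1, …, S_w`, as printed.
[cite: AgrawalEtAl2011, Lemma 4.1 (= lem:derivative-content), second bullet]
locator: paper:arxiv-1111.0582 p0009.txt:L93–L96; p0018.txt:L58–L62 -/
theorem iterPderiv_prod_pow_eq_mul_filter [DecidableEq σ] {J : Type*} (s : Finset J)
    (H : J → MvPolynomial σ R) (e : J → ℕ) (β : σ →₀ ℕ) (P : J → Prop) [DecidablePred P]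
    (hP : ∀ j ∈ s, ¬ P j → ∀ i ∈ β.support, i ∉ (H j).vars) :
    iterPderiv (A := R) β (∏ j ∈ s, H j ^ e j) =
      (∏ j ∈ s.filter (fun j => ¬ P j), H j ^ e j) *
        iterPderiv (A := R) β (∏ j ∈ s.filter P, H j ^ e j) := by
  rw [← Finset.prod_filter_mul_prod_filter_not s P, mul_comm]
  refine iterPderiv_mul_left_of_forall_notMem_vars β (fun i hi => ?_) _
  exact notMem_vars_prod_pow _ H e fun j hj => hP j (Finset.mem_filter.mp hj).1
    (Finset.mem_filter.mp hj).2 i hi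

/-- **Lemma 4.1 (gcd trick), `+` gate, polynomial level:** for `S ≠ ∅`,
`Δ_S (∑_j H_j) = ∑_{P} Δ_S H_j` — the children not depending on `var(S)` drop out ("let `G'` be
the sum of these children. Then `Δ_{S_i}G = Δ_{S_i}G'`", `V_G = 1`).
[cite: AgrawalEtAl2011, Lemma 4.1 (= lem:derivative-content), first bullet]
locator: paper:arxiv-1111.0582 p0009.txt:L89–L92; p0018.txt:L53–L56 -/
theorem iterPderiv_sum_eq_sum_filter {J : Type*} (s : Finset J) (H : J → MvPolynomial σ R)
    {β : σ →₀ ℕ} (hβ : β ≠ 0) (P : J → Prop) [DecidablePred P]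
    (hP : ∀ j ∈ s, ¬ P j → ∀ i ∈ β.support, i ∉ (H j).vars) :
    iterPderiv (A := R) β (∑ j ∈ s, H j) = ∑ j ∈ s.filter P, iterPderiv (A := R) β (H j) := by
  obtain ⟨i, hi⟩ : β.support.Nonempty := Finsupp.support_nonempty_iff.mpr hβ
  rw [iterPderiv_sum, Finset.sum_filter]
  refine Finset.sum_congr rfl fun j hj => ?_
  split_ifs with h
  · rfl
  · exact iterPderiv_eq_zero_of_notMem_vars hi (hP j hj h i hi)

/-! ### The counts -/

/-- **The occur count of Lemma 4.1:** if every variable occurs in at most `k` of the children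
`H_j`, then at most `k · |V|` children depend on a variable of `V` ("at most `k·|∪ var(S_i)|` of its
children depend on the variables present in `∪ var(S_i)`").
[cite: AgrawalEtAl2011, Lemma 4.1 (= lem:derivative-content), both bullets]
locator: paper:arxiv-1111.0582 p0018.txt:L53–L60 -/
theorem card_filter_dependsOn_le [DecidableEq σ] {J : Type*} [DecidableEq J] (s : Finset J)
    (H : J → MvPolynomial σ R) (V : Finset σ) (k : ℕ)
    (hk : ∀ i ∈ V, (s.filter fun j => i ∈ (H j).vars).card ≤ k) :
    (s.filter fun j => ∃ i ∈ V, i ∈ (H j).vars).card ≤ k * V.card := by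
  have hsub : (s.filter fun j => ∃ i ∈ V, i ∈ (H j).vars) ⊆
      V.biUnion fun i => s.filter fun j => i ∈ (H j).vars := by
    intro j hj
    obtain ⟨hjs, i, hiV, hij⟩ := Finset.mem_filter.mp hj
    exact Finset.mem_biUnion.mpr ⟨i, hiV, Finset.mem_filter.mpr ⟨hjs, hij⟩⟩
  refine (Finset.card_le_card hsub).trans ((Finset.card_biUnion_le).trans ?_)
  rw [mul_comm]
  exact Finset.sum_le_card_nsmul _ _ _ hk

/-- **The derivative count of Lemma 4.2:** a multiset `S` with `|S| = c` has at most `2^c`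
sub-multisets `T ⊆ S` (the `Δ_T H_j`, `∅ ≠ T ⊆ S_i`, are "at most `(2^{c_ℓ+1} - 1)`" per child).
[cite: AgrawalEtAl2011, Lemma 4.2 (= lem:descent-jacobian), proof]
locator: paper:arxiv-1111.0582 p0018.txt:L108–L110 -/
theorem card_Iic_le_two_pow_degree [DecidableEq σ] (β : σ →₀ ℕ) :
    (Finset.Iic β).card ≤ 2 ^ β.degree := by
  rw [Finsupp.card_Iic, Finsupp.degree_apply, ← Finset.prod_pow_eq_pow_sum]
  refine Finset.prod_le_prod' fun i _ => ?_
  rw [Nat.card_Iic]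
  exact Nat.succ_le_of_lt (Nat.lt_two_pow_self)

/-! ### Determinants: common row factors and "polynomial in the entries" -/

/-- **"Take `V_G` common from each of these `e_G` rows":** if row `i` of `M` is `v_i` times row
`i` of `N`, then `det M = (∏_i v_i) · det N` (Mathlib's `Matrix.det_mul_column`).
[cite: AgrawalEtAl2011, Lemma 4.2 (= lem:descent-jacobian), proof]
locator: paper:arxiv-1111.0582 p0018.txt:L97–L100 -/
theorem det_eq_prod_mul_det_of_row_factor {n : Type*} [Fintype n] [DecidableEq n] {S : Type*}
    [CommRing S] (v : n → S) (M N : Matrix n n S) (h : ∀ i j, M i j = v i * N i j) :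
    M.det = (∏ i, v i) * N.det := by
  rw [← Matrix.det_mul_column v N]
  congr 1
  ext i j
  rw [Matrix.of_apply, h]

/-- **"`det(…)` is a polynomial in" its entries:** a determinant with entries in a subalgebra lies
in that subalgebra. [cite: AgrawalEtAl2011, §4 (proof idea: "`det(∂_j ∏ P^{e})` is a polynomial in `P_{i,ℓ}` and `∂_j P_{i,ℓ}`")]
locator: paper:arxiv-1111.0582 p0009.txt:L48–L51 -/
theorem det_mem_subalgebra {n : Type*} [Fintype n] [DecidableEq n] {S : Type*} [CommRing S]
    [Algebra R S] (T : Subalgebra R S) (M : Matrix n n S) (h : ∀ i j, M i j ∈ T) : M.det ∈ T := by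
  rw [Matrix.det_apply]
  refine Subalgebra.sum_mem _ fun τ _ => ?_
  rw [Units.smul_def]
  exact zsmul_mem (Subalgebra.prod_mem _ fun i _ => h _ _) _

/-- **The Jacobian entries of derivatives are derivatives:** `∂_j (Δ_β G) = Δ_{x_j + β} G` — the
"up to `(c_ℓ + 1)`-order derivatives of `G`" filling the `e_G` rows of the Jacobian sub-matrix
`M`. [cite: AgrawalEtAl2011, Lemma 4.2 (= lem:descent-jacobian), proof]
locator: paper:arxiv-1111.0582 p0018.txt:L90–L94 -/
theorem pderiv_iterPderiv (j : σ) (β : σ →₀ ℕ) (G : MvPolynomial σ R) :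
    pderiv j (iterPderiv (A := R) β G) = iterPderiv (A := R) (Finsupp.single j 1 + β) G :=
  (iterPderiv_single_add_apply j β G).symm

/-- … and its order is `|β| + 1 ≤ c_ℓ + 1` ("`|S_i| ≤ c_ℓ + 1`").
[cite: AgrawalEtAl2011, Lemma 4.2 (= lem:descent-jacobian), proof] locator: paper:arxiv-1111.0582 p0018.txt:L101 -/
theorem degree_single_add (j : σ) (β : σ →₀ ℕ) :
    (Finsupp.single j 1 + β).degree = β.degree + 1 := by
  rw [map_add, Finsupp.degree_single, add_comm]

/-! ### Lemma 4.2 at the level of polynomials: the Jacobian rows of the derivatives of a gate -/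

/-- **One Jacobian entry of Lemma 4.2, `×∧` gate:** for `U = Δ_β G`, `G = ∏_{j ∈ s} H_j^{e_j}`, and a
predicate `P` containing every child that depends on a variable of `x_v + β`:
`∂_{x_v} U = V_G · Δ_{x_v + β} (∏_{P} H_j^{e_j})` with `V_G = ∏_{¬P} H_j^{e_j}`.
[cite: AgrawalEtAl2011, Lemma 4.2 (= lem:descent-jacobian), proof (rows of `G`) with Lemma 4.1]
locator: paper:arxiv-1111.0582 p0018.txt:L88–L100 -/
theorem pderiv_iterPderiv_prod_pow_eq [DecidableEq σ] {J : Type*} (s : Finset J)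
    (H : J → MvPolynomial σ R) (e : J → ℕ) (β : σ →₀ ℕ) (x : σ) (P : J → Prop) [DecidablePred P]
    (hP : ∀ j ∈ s, ¬ P j → ∀ i ∈ (Finsupp.single x 1 + β).support, i ∉ (H j).vars) :
    pderiv x (iterPderiv (A := R) β (∏ j ∈ s, H j ^ e j)) =
      (∏ j ∈ s.filter (fun j => ¬ P j), H j ^ e j) *
        iterPderiv (A := R) (Finsupp.single x 1 + β) (∏ j ∈ s.filter P, H j ^ e j) := by
  rw [pderiv_iterPderiv, iterPderiv_prod_pow_eq_mul_filter s H e _ P hP]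

/-- **One Jacobian entry of Lemma 4.2, `+` gate:** `∂_{x_v} Δ_β (∑_j H_j) = ∑_{P} Δ_{x_v + β} H_j`
(`V_G = 1`). [cite: AgrawalEtAl2011, Lemma 4.2 (= lem:descent-jacobian), proof (rows of `G`) with Lemma 4.1]
locator: paper:arxiv-1111.0582 p0018.txt:L88–L104 -/
theorem pderiv_iterPderiv_sum_eq {J : Type*} (s : Finset J) (H : J → MvPolynomial σ R)
    (β : σ →₀ ℕ) (x : σ) (P : J → Prop) [DecidablePred P]
    (hP : ∀ j ∈ s, ¬ P j → ∀ i ∈ (Finsupp.single x 1 + β).support, i ∉ (H j).vars) :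
    pderiv x (iterPderiv (A := R) β (∑ j ∈ s, H j)) =
      ∑ j ∈ s.filter P, iterPderiv (A := R) (Finsupp.single x 1 + β) (H j) := by
  rw [pderiv_iterPderiv]
  refine iterPderiv_sum_eq_sum_filter s H (fun h => ?_) P hP
  have := congrArg (fun f : σ →₀ ℕ => f x) h
  simp only [Finsupp.add_apply, Finsupp.single_eq_same, Finsupp.coe_zero, Pi.zero_apply] at this
  omega

/-- **Lemma 4.2 (evolution via factoring) for a family of `×∧` gates, polynomial level.** Rows
`u` of a Jacobian sub-matrix are indexed by derivatives `U_u = Δ_{β_u} G_{g_u}` of gates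
`G_g = ∏_{j ∈ ch g} H_j^{e_j}`, columns by variables `x_v`; with `P_g` containing every child of
`G_g` that depends on a variable differentiated in a row of `G_g`:
`det(∂_{x_v} U_u) = (∏_u V_{G_{g_u}}) · det(Δ_{x_v + β_u} G'_{g_u})` — "`det(M)` can be expressed as a
product `∏_{G} V_G^{e_G}` and a polynomial `V` in … derivatives" (`e_G` = the number of rows of
`G`, here the multiplicity of `g` among the `g_u`).
[cite: AgrawalEtAl2011, Lemma 4.2 (= lem:descent-jacobian)] locator: paper:arxiv-1111.0582 p0010.txt:L12–L21; p0018.txt:L72–L130 -/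
theorem det_jacobian_prod_pow_eq [DecidableEq σ] {𝒢 J : Type*} {r : ℕ} (ch : 𝒢 → Finset J)
    (H : J → MvPolynomial σ R) (e : J → ℕ) (g : Fin r → 𝒢) (β : Fin r → σ →₀ ℕ) (x : Fin r → σ)
    (P : 𝒢 → J → Prop) [∀ a, DecidablePred (P a)]
    (hP : ∀ u v, ∀ j ∈ ch (g u), ¬ P (g u) j →
      ∀ i ∈ (Finsupp.single (x v) 1 + β u).support, i ∉ (H j).vars) :
    (Matrix.of fun u v =>
        pderiv (x v) (iterPderiv (A := R) (β u) (∏ j ∈ ch (g u), H j ^ e j))).det =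
      (∏ u, ∏ j ∈ (ch (g u)).filter (fun j => ¬ P (g u) j), H j ^ e j) *
        (Matrix.of fun u v => iterPderiv (A := R) (Finsupp.single (x v) 1 + β u)
          (∏ j ∈ (ch (g u)).filter (P (g u)), H j ^ e j)).det := by
  refine det_eq_prod_mul_det_of_row_factor _ _ _ fun u v => ?_
  rw [Matrix.of_apply, Matrix.of_apply]
  exact pderiv_iterPderiv_prod_pow_eq _ H e (β u) (x v) (P (g u)) (hP u v)

/-- … and the remaining determinant `V` is a polynomial in the derivatives `Δ_γ H_j` of the kept
children, of orders `γ ≤ x_v + β_u` ("a polynomial `V` in at most … derivatives (of order up to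
`c_ℓ + 1`) of a group of gates in level `ℓ + 1`").
[cite: AgrawalEtAl2011, Lemma 4.2 (= lem:descent-jacobian)] locator: paper:arxiv-1111.0582 p0018.txt:L120–L127 -/
theorem det_jacobian_prod_pow_mem_adjoin [DecidableEq σ] {𝒢 J : Type*} {r : ℕ} (ch : 𝒢 → Finset J)
    (H : J → MvPolynomial σ R) (e : J → ℕ) (g : Fin r → 𝒢) (β : Fin r → σ →₀ ℕ) (x : Fin r → σ)
    (P : 𝒢 → J → Prop) [∀ a, DecidablePred (P a)] :
    (Matrix.of fun u v => iterPderiv (A := R) (Finsupp.single (x v) 1 + β u)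
        (∏ j ∈ (ch (g u)).filter (P (g u)), H j ^ e j)).det ∈
      Algebra.adjoin R {f | ∃ u v : Fin r, ∃ j ∈ (ch (g u)).filter (P (g u)), ∃ γ : σ →₀ ℕ,
        γ ≤ Finsupp.single (x v) 1 + β u ∧ f = iterPderiv (A := R) γ (H j)} := by
  refine det_mem_subalgebra _ _ fun u v => ?_
  rw [Matrix.of_apply]
  refine Algebra.adjoin_mono ?_ (iterPderiv_prod_pow_mem_adjoin _ H e _)
  rintro f ⟨j, hj, γ, hγ, rfl⟩
  exact ⟨u, v, j, hj, γ, hγ, rfl⟩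

/-- **Lemma 4.2 for a family of `+` gates, polynomial level:** `det(∂_{x_v} Δ_{β_u} ∑_j H_j) =
det(∑_{P} Δ_{x_v + β_u} H_j)` (no factor), again a polynomial in derivatives of the kept children.
[cite: AgrawalEtAl2011, Lemma 4.2 (= lem:descent-jacobian)] locator: paper:arxiv-1111.0582 p0018.txt:L102–L110 -/
theorem det_jacobian_sum_eq {𝒢 J : Type*} {r : ℕ} (ch : 𝒢 → Finset J) (H : J → MvPolynomial σ R)
    (g : Fin r → 𝒢) (β : Fin r → σ →₀ ℕ) (x : Fin r → σ) (P : 𝒢 → J → Prop)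
    [∀ a, DecidablePred (P a)]
    (hP : ∀ u v, ∀ j ∈ ch (g u), ¬ P (g u) j →
      ∀ i ∈ (Finsupp.single (x v) 1 + β u).support, i ∉ (H j).vars) :
    (Matrix.of fun u v => pderiv (x v) (iterPderiv (A := R) (β u) (∑ j ∈ ch (g u), H j))).det =
      (Matrix.of fun u v => ∑ j ∈ (ch (g u)).filter (P (g u)),
        iterPderiv (A := R) (Finsupp.single (x v) 1 + β u) (H j)).det := by
  congr 1
  refine Matrix.ext fun u v => ?_
  rw [Matrix.of_apply, Matrix.of_apply]
  exact pderiv_iterPderiv_sum_eq _ H (β u) (x v) (P (g u)) (hP u v)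

/-- … membership: `det(∑_{P} Δ_{x_v + β_u} H_j)` is a polynomial in the `Δ_γ H_j`, `γ ≤ x_v + β_u`,
`j` kept. [cite: AgrawalEtAl2011, Lemma 4.2 (= lem:descent-jacobian)] locator: paper:arxiv-1111.0582 p0018.txt:L102–L110 -/
theorem det_jacobian_sum_mem_adjoin {𝒢 J : Type*} {r : ℕ} (ch : 𝒢 → Finset J)
    (H : J → MvPolynomial σ R) (g : Fin r → 𝒢) (β : Fin r → σ →₀ ℕ) (x : Fin r → σ)
    (P : 𝒢 → J → Prop) [∀ a, DecidablePred (P a)] :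
    (Matrix.of fun u v => ∑ j ∈ (ch (g u)).filter (P (g u)),
        iterPderiv (A := R) (Finsupp.single (x v) 1 + β u) (H j)).det ∈
      Algebra.adjoin R {f | ∃ u v : Fin r, ∃ j ∈ (ch (g u)).filter (P (g u)), ∃ γ : σ →₀ ℕ,
        γ ≤ Finsupp.single (x v) 1 + β u ∧ f = iterPderiv (A := R) γ (H j)} := by
  refine det_mem_subalgebra _ _ fun u v => ?_
  rw [Matrix.of_apply]
  refine Subalgebra.sum_mem _ fun j hj => Algebra.subset_adjoin ?_
  exact ⟨u, v, j, hj, _, le_rfl, rfl⟩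

/-! ### Counting glue for the level recursion of Lemma 4.2 (the printed count, p0018:L112–L127 and p0019:L1–L10) -/

/-- **Refined generator set ("the children of `G'` and their derivatives of order between one and
`c_ℓ+1`, for each `H_j` depending on `var(S_i)`").** `Δ_β (∏_{j∈s} H_j^{e_j})` is a polynomial in
the ORDER-ZERO children `H_j` (`j ∈ s`) and the derivatives `Δ_γ H_j` with `0 ≠ γ ≤ β` of those
children that involve EVERY variable of `γ` (the other `Δ_γ H_j` vanish). [cite: AgrawalEtAl2011, Lemma 4.2 (= lem:descent-jacobian), proof]
locator: paper:arxiv-1111.0582 p0018.txt:L112–L127 -/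
theorem iterPderiv_prod_pow_mem_adjoin_refined [DecidableEq σ] {J : Type*} (s : Finset J)
    (H : J → MvPolynomial σ R) (e : J → ℕ) (β : σ →₀ ℕ) :
    iterPderiv (A := R) β (∏ j ∈ s, H j ^ e j) ∈
      Algebra.adjoin R ({f | ∃ j ∈ s, f = H j} ∪
        {f | ∃ j ∈ s, ∃ γ : σ →₀ ℕ, γ ≠ 0 ∧ γ ≤ β ∧ (∀ i ∈ γ.support, i ∈ (H j).vars) ∧
          f = iterPderiv (A := R) γ (H j)}) := by
  refine (Algebra.adjoin_le ?_ : _ ≤ _) (iterPderiv_prod_pow_mem_adjoin s H e β)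
  rintro f ⟨j, hj, γ, hγ, rfl⟩
  by_cases h0 : γ = 0
  · subst h0
    refine Algebra.subset_adjoin (Or.inl ⟨j, hj, ?_⟩)
    rw [iterPderiv_zero, LinearMap.id_apply]
  · by_cases hv : ∀ i ∈ γ.support, i ∈ (H j).vars
    · exact Algebra.subset_adjoin (Or.inr ⟨j, hj, γ, h0, hγ, hv, rfl⟩)
    · push Not at hv
      obtain ⟨i, hi, hiv⟩ := hv
      rw [iterPderiv_eq_zero_of_notMem_vars hi hiv]
      exact Subalgebra.zero_mem _

/-- Same refinement for a `+` gate and `β ≠ 0`: `Δ_β (∑_{j∈s} H_j)` is the SUM of the `Δ_β H_j`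
over the children involving every variable of `β` (the others vanish).
[cite: AgrawalEtAl2011, Lemma 4.2 (= lem:descent-jacobian), proof ("If `G'` is a `+` gate, then `Δ_{S_i}G'` is the sum of the derivatives of … its children (that depend on `var(S_i)`)")]
locator: paper:arxiv-1111.0582 p0018.txt:L112–L116 -/
theorem iterPderiv_sum_eq_sum_filter_forall [DecidableEq σ] {J : Type*} (s : Finset J)
    (H : J → MvPolynomial σ R) (β : σ →₀ ℕ) :
    iterPderiv (A := R) β (∑ j ∈ s, H j) =
      ∑ j ∈ s.filter (fun j => ∀ i ∈ β.support, i ∈ (H j).vars), iterPderiv (A := R) β (H j) := by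
  classical
  rw [iterPderiv_sum, Finset.sum_filter]
  refine Finset.sum_congr rfl fun j _ => ?_
  split_ifs with h
  · rfl
  · push Not at h
    obtain ⟨i, hi, hiv⟩ := h
    exact iterPderiv_eq_zero_of_notMem_vars hi hiv

/-- **Counting the refined derivative generators, children:** if every variable lies in at most `k`
of the `H_j` (occur-`k`), then for `γ ≠ 0` at most `k` children involve every variable of `γ` (pick
any `i ∈ var(γ)`) — sharper than the printed "`k(c_ℓ+1)` children of `G'` depend on `var(S_i)`".
[cite: AgrawalEtAl2011, Lemma 4.2 (= lem:descent-jacobian), proof ("at most `k(c_ℓ + 1)` children of `G'` depend on `var(S_i)`")]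
locator: paper:arxiv-1111.0582 p0018.txt:L112–L113 -/
theorem card_filter_forall_mem_vars_le [DecidableEq σ] {J : Type*} (s : Finset J)
    (H : J → MvPolynomial σ R) {k : ℕ} (hk : ∀ i, (s.filter fun j => i ∈ (H j).vars).card ≤ k)
    {γ : σ →₀ ℕ} (hγ : γ ≠ 0) :
    (s.filter fun j => ∀ i ∈ γ.support, i ∈ (H j).vars).card ≤ k := by
  obtain ⟨i, hi⟩ : γ.support.Nonempty := Finsupp.support_nonempty_iff.mpr hγ
  refine (Finset.card_le_card ?_).trans (hk i)
  intro j hj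
  rw [Finset.mem_filter] at hj ⊢
  exact ⟨hj.1, hj.2 i hi⟩

/-- **Counting the refined derivative generators, orders:** the nonzero sub-multisets `0 ≠ γ ≤ β`
number at most `2^{|β|} - 1` ("`{Δ_T H_j}_{∅ ≠ T ⊆ S_i}` … at most `(2^{c_ℓ+1} - 1)·…` many
derivatives"). [cite: AgrawalEtAl2011, Lemma 4.2 (= lem:descent-jacobian), proof]
locator: paper:arxiv-1111.0582 p0018.txt:L118–L127 -/
theorem card_Iic_filter_ne_zero_le [DecidableEq σ] (β : σ →₀ ℕ) :
    ((Finset.Iic β).filter fun γ => γ ≠ 0).card ≤ 2 ^ β.degree - 1 := by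
  have h0 : (0 : σ →₀ ℕ) ∈ Finset.Iic β := Finset.mem_Iic.mpr bot_le
  have h1 : ((Finset.Iic β).filter fun γ => γ ≠ 0) = (Finset.Iic β).erase 0 := by
    ext γ
    simp only [Finset.mem_filter, Finset.mem_erase, ne_eq, and_comm]
  rw [h1, Finset.card_erase_of_mem h0]
  exact Nat.sub_le_sub_right (card_Iic_le_two_pow_degree β) 1

/-- **The printed level count:** `k(r_ℓ c_ℓ + r_ℓ²) + r_ℓ²·(2^{c_ℓ+1} - 1)·k·(c_ℓ+1) ≤
(c_ℓ+1)·2^{c_ℓ+1}·k·r_ℓ² = r_{ℓ+1}` (uses `r_ℓ·c_ℓ ≤ r_ℓ²·c_ℓ`).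
[cite: AgrawalEtAl2011, Lemma 4.2 (= lem:descent-jacobian), proof (last display)]
locator: paper:arxiv-1111.0582 p0019.txt:L4–L10 (the closing display of the proof of lem:descent-jacobian) -/
theorem level_count_le (k r c : ℕ) :
    k * (r * c + r ^ 2) + r ^ 2 * (2 ^ (c + 1) - 1) * k * (c + 1) ≤
      (c + 1) * 2 ^ (c + 1) * k * r ^ 2 := by
  have h2 : 1 ≤ 2 ^ (c + 1) := Nat.one_le_two_pow
  obtain ⟨m, hm⟩ : ∃ m, 2 ^ (c + 1) = m + 1 := ⟨2 ^ (c + 1) - 1, by omega⟩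
  rw [hm, Nat.add_sub_cancel]
  have hrc : r * c ≤ r ^ 2 * c := by
    rw [sq]
    rcases Nat.eq_zero_or_pos r with rfl | hr
    · simp
    · exact Nat.mul_le_mul_right c (Nat.le_mul_of_pos_left r hr)
  calc k * (r * c + r ^ 2) + r ^ 2 * m * k * (c + 1)
      ≤ k * (r ^ 2 * c + r ^ 2) + r ^ 2 * m * k * (c + 1) :=
        Nat.add_le_add_right (Nat.mul_le_mul_left k (Nat.add_le_add_right hrc _)) _
    _ = (c + 1) * (m + 1) * k * r ^ 2 := by ring

/-! ### Transporting non-vanishing of the factored minor along the next level's map (Cor. 4.3 glue) -/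

/-- **Injectivity on the generated algebra, from the "`C(f) ≠ 0 ⇒ C(Ψ f) ≠ 0`" form** (the shape in
which [ASSS16] Thm. 2.1 / FSV Lemma 52 deliver faithfulness): if `Ψ` preserves non-vanishing of every
polynomial expression in a family `E`, it does not kill any nonzero element of `R[E]` — used for
the cofactor polynomial `V ∈ R[Elem(V)]` of Lemma 4.2.
[cite: AgrawalEtAl2011, §4 (¶ after Lemma 4.2: "`V_i` is a polynomial in a set of derivatives … `Elem(V_i)`") and Cor. 4.3]
locator: paper:arxiv-1111.0582 p0010.txt:L27–L43 -/
theorem algHom_apply_ne_zero_of_mem_adjoin_range {S T : Type*} [CommRing S] [CommRing T]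
    [Algebra R S] [Algebra R T] (Ψ : S →ₐ[R] T) {κ : Type*} (E : κ → S)
    (hinj : ∀ C : MvPolynomial κ R, aeval E C ≠ 0 → aeval (fun i => Ψ (E i)) C ≠ 0)
    {V : S} (hV : V ∈ Algebra.adjoin R (Set.range E)) (hV0 : V ≠ 0) : Ψ V ≠ 0 := by
  rw [Algebra.adjoin_range_eq_range_aeval] at hV
  obtain ⟨C, hC⟩ := hV
  have hC' : aeval E C = V := hC
  rw [← hC', show Ψ (aeval E C) = (Ψ.comp (aeval E)) C from rfl, comp_aeval]
  exact hinj C (hC'.symm ▸ hV0)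

/-- **`Ψ(V_G) ≠ 0` from the children:** a product of powers survives `Ψ` as soon as each factor
does ("`V_G = G/G'`" is handled through its factors, each a single child `H_j`).
[cite: AgrawalEtAl2011, Lemma 4.2 (= lem:descent-jacobian) with Cor. 4.3] locator: paper:arxiv-1111.0582 p0010.txt:L12–L43 -/
theorem algHom_prod_pow_ne_zero {S T : Type*} [CommRing S] [CommRing T] [IsDomain T]
    [Algebra R S] [Algebra R T] (Ψ : S →ₐ[R] T) {J : Type*} (s : Finset J) (H : J → S)
    (e : J → ℕ) (hH : ∀ j ∈ s, Ψ (H j) ≠ 0) : Ψ (∏ j ∈ s, H j ^ e j) ≠ 0 := by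
  rw [map_prod]
  refine Finset.prod_ne_zero_iff.mpr fun j hj => ?_
  rw [map_pow]
  exact pow_ne_zero _ (hH j hj)

/-- **`Ψ(det M) ≠ 0` from the factorisation `det M = (∏_u V_u) · det N`:** the row factors and
the cofactor determinant survive separately.
[cite: AgrawalEtAl2011, Lemma 4.2 (= lem:descent-jacobian) with Cor. 4.3] locator: paper:arxiv-1111.0582 p0010.txt:L12–L43 -/
theorem algHom_prod_mul_ne_zero {S T : Type*} [CommRing S] [CommRing T] [IsDomain T]
    [Algebra R S] [Algebra R T] (Ψ : S →ₐ[R] T) {ι' : Type*} [Fintype ι'] (v : ι' → S) (N : S)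
    (hv : ∀ u, Ψ (v u) ≠ 0) (hN : Ψ N ≠ 0) : Ψ ((∏ u, v u) * N) ≠ 0 := by
  rw [map_mul, map_prod]
  exact mul_ne_zero (Finset.prod_ne_zero_iff.mpr fun u _ => hv u) hN

/-! ### Degree bookkeeping for the level families (the `d` of Lemma 2.2's `char > d^r`) -/

/-- **Derivatives do not raise the total degree:** `deg Δ_β f ≤ deg f` (each monomial `x^s` goes to
a multiple of `x^{s-β}`), so the level-`ℓ` derivative families inherit the degree bound of the
sub-formulas they come from — the `d` in the hypothesis "`char(𝔽) = 0` or `> d^r`" of the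
faithful-lift Lemma 2.2 / FSV Lemma 52 used at every level of the recursion.
[cite: AgrawalEtAl2011, Lemma 2.2 (hypothesis "degree at most `d` … char `> d^r`") with §4 Cor. 4.3]
locator: paper:arxiv-1111.0582 p0006.txt:L45–L50; p0010.txt:L37–L43 -/
theorem totalDegree_iterPderiv_le [DecidableEq σ] (β : σ →₀ ℕ) (f : MvPolynomial σ R) :
    (iterPderiv (A := R) β f).totalDegree ≤ f.totalDegree := by
  classical
  have hsum : iterPderiv (A := R) β f =
      ∑ s ∈ f.support, monomial (s - β) (coeff s f *
        (Literature.RepresentationTheory.AlgebraicGroups.iterPderivWeight β s : R)) := by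
    conv_lhs => rw [f.as_sum]
    rw [map_sum]
    exact Finset.sum_congr rfl fun s _ =>
      Literature.RepresentationTheory.AlgebraicGroups.iterPderiv_monomial β s _
  rw [hsum]
  refine (totalDegree_finsetSum _ _).trans (Finset.sup_le fun s hs => ?_)
  refine (totalDegree_monomial_le _ _).trans ?_
  refine le_trans ?_ (le_totalDegree hs)
  show ∑ i ∈ (s - β).support, (s - β) i ≤ ∑ i ∈ s.support, s i
  calc ∑ i ∈ (s - β).support, (s - β) i ≤ ∑ i ∈ (s - β).support, s i :=
        Finset.sum_le_sum fun i _ => by rw [Finsupp.tsub_apply]; exact tsub_le_self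
    _ ≤ ∑ i ∈ s.support, s i :=
        Finset.sum_le_sum_of_subset_of_nonneg Finsupp.support_tsub fun _ _ _ => Nat.zero_le _

/-- `deg ∂_x Δ_β f ≤ deg f` — the Jacobian entries of a derivative family obey the same bound.
[cite: AgrawalEtAl2011, Lemma 2.2 with §4 Cor. 4.3] locator: paper:arxiv-1111.0582 p0006.txt:L45–L50 -/
theorem totalDegree_pderiv_iterPderiv_le [DecidableEq σ] (x : σ) (β : σ →₀ ℕ)
    (f : MvPolynomial σ R) :
    (pderiv x (iterPderiv (A := R) β f)).totalDegree ≤ f.totalDegree := by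
  rw [pderiv_iterPderiv]
  exact totalDegree_iterPderiv_le _ _

end ASSS16

end Literature.Computability.AlgebraicComplexity
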